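import Summits.QuantumFields.YangMills.Theorems.ColdStartUniversalityShenZhuZhuWilsonLoopConcentrationSU2
import Summits.QuantumFields.YangMills.Theorems.ColdStartUniversalityShenZhuZhuFunctionalInequalitiesSU2
import HarnessLib

/-!
# Variance of WILSON LOOPS under every infinite-volume limit point of three-dimensional `SU(2)` lattice Yang–Mills at strong
# coupling: `Var_μ(W_C) ≤ Σ_e mult_C(e)² / (2(1 − 24|β|))`, `= |C|/(2(1 − 24|β|))` for trails

Seat `ym-line-csu-p1` (g38), route `ColdStartUniversality` of `Summits/QuantumFields/YangMills`, helper file G6 — the Poincaré companion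
of G5 (`…ShenZhuZhuWilsonLoopConcentrationSU2`): the seat's sharp functional inequalities for infinite-volume limit points
(`szzFunctionalInequalitiesWith_su2_sharp : SZZFunctionalInequalitiesWith 3 2 β (1 − 24|β|)`, g38) applied to the Wilson loop observable,
which G5 showed to be a smooth `mult_C(e)/√2`-Lipschitz matrix cylinder (`exists_smooth_linkLipschitz_wilsonLoopObs`).

* ★★ `szz_wilsonLoop_variance_su2` — for EVERY infinite-volume limit point `μ` of the periodic Wilson states of `SU(2)` lattice
  Yang–Mills on `ℤ³` at 't Hooft coupling `|β| < 1/24` and every closed walk `C`: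
  `Var_μ(W_C) ≤ Σ_{e ∈ links(C)} mult_C(e)² / (2 (1 − 24|β|))`, `W_C = ½ Re tr hol_C`.
* ★★ `szz_wilsonLoop_variance_su2_of_isTrail` — for a closed trail: `Var_μ(W_C) ≤ |C| / (2 (1 − 24|β|))` — PERIMETER growth of
  Wilson-loop fluctuations (Shen–Zhu–Zhu, CMP 400 (2023), Cor. 1.5 / Rem. 4.6 print `Var(W_C) ≲ |C|/(K_S N)` on the window
  `|β| < 1/(16(d−1)) = 1/32` with `K_S = 1 − 32|β|`; here the window is `1/24` and the constant `1 − 24|β|`; the venture `YMGap` has the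
  analogue for DLR states on its Dobrushin window).
* `szz_wilsonLoop_entropy_su2` — the defective log-Sobolev form `Ent_μ(W_C²) ≤ Σ_e mult_C(e)² / (1 − 24|β|)`.

THEOREMS ONLY, no definition, no sorry.  HONEST FRAMING: STRONG coupling (`|β| < 1/24` 't Hooft), fixed lattice, `SU(2)`, `d = 3`; nothing
at weak coupling / in the continuum, no area law, nothing `K`-uniform along the route's scaling (`UniformColdStartMixing`, 24809, ASIDE, not
restated); no crux, rung or summit statement is proved; the Yang–Mills mass gap is NOT proved.

References: H. Shen, R. Zhu, X. Zhu, CMP 400 (2023) 805–851 = arXiv:2204.12737, Thm 1.4, Cor. 1.5, Rem. 4.6 [ShenZhuZhu2022].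
-/

set_option autoImplicit false

noncomputable section

namespace Summit.QuantumFields.YangMills.Theorems.ColdStartUniversality

open MeasureTheory ProbabilityTheory Finset Filter Set
open scoped BigOperators NNReal ENNReal Topology Matrix Matrix.Norms.Frobenius ContDiff
open SimpleGraph
open Literature.Probability.LatticeModels (Site zdGraph)
open Literature.MathematicalPhysics.QuantumFieldTheory
open Literature.MathematicalPhysics.QuantumLattice (fundamentalRep fundamentalRep_apply infiniteVolumeLimitPoints LGConfig
  normalisedCharacter wilsonLoopObs loopExpectation)
open Summit.Ventures.YMGap.RobustBall (dartMult)

/-- **Variance and entropy of Wilson loops** under every infinite-volume limit point of `SU(2)` lattice Yang–Mills on `ℤ³` at 't Hooft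
coupling `|β| < 1/24` (both clauses of the sharp functional inequalities, for the Wilson loop of a closed walk `C`):
`Ent_μ(W_C²) ≤ Σ_e mult_C(e)² / (1 − 24|β|)` and `Var_μ(W_C) ≤ Σ_e mult_C(e)² / (2(1 − 24|β|))`.
The Yang–Mills mass gap is NOT proved. [cite: ShenZhuZhu2022, Theorem 1.4, Corollary 1.5] -/
theorem szz_wilsonLoop_entropy_variance_su2 {β : ℝ} (hβ : |β| < 1 / 24)
    {μ : Measure (LGConfig 3 (Matrix.specialUnitaryGroup (Fin 2) ℂ))}
    (hμ : μ ∈ infiniteVolumeLimitPoints (d := 3) (fundamentalRep (Fin 2)) (((2 : ℕ) : ℝ) * β))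
    {x : Site 3} (w : (zdGraph 3).Walk x x) :
    (∫ U, wilsonLoopObs (fun g : Matrix.specialUnitaryGroup (Fin 2) ℂ => normalisedCharacter 2 (fundamentalRep (Fin 2) g)) w U ^ 2 *
          Real.log (wilsonLoopObs (fun g : Matrix.specialUnitaryGroup (Fin 2) ℂ => normalisedCharacter 2 (fundamentalRep (Fin 2) g)) w U ^ 2) ∂μ -
        (∫ U, wilsonLoopObs (fun g : Matrix.specialUnitaryGroup (Fin 2) ℂ => normalisedCharacter 2 (fundamentalRep (Fin 2) g)) w U ^ 2 ∂μ) *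
          Real.log (∫ U, wilsonLoopObs (fun g : Matrix.specialUnitaryGroup (Fin 2) ℂ => normalisedCharacter 2 (fundamentalRep (Fin 2) g)) w U ^ 2 ∂μ)
        ≤ (∑ e ∈ walkEdges w, (dartMult w e : ℝ) ^ 2) / (1 - 24 * |β|)) ∧
    Var[wilsonLoopObs (fun g : Matrix.specialUnitaryGroup (Fin 2) ℂ => normalisedCharacter 2 (fundamentalRep (Fin 2) g)) w; μ] ≤
      (∑ e ∈ walkEdges w, (dartMult w e : ℝ) ^ 2) / (2 * (1 - 24 * |β|)) := by
  classical
  obtain ⟨f, hf, hrep, hLip⟩ := exists_smooth_linkLipschitz_wilsonLoopObs (N := 2) w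
  set L : ↥(walkEdges w) → ℝ := fun e =>
    (dartMult w (e : Literature.MathematicalPhysics.QuantumLattice.ZdEdge 3) : ℝ) / Real.sqrt ((2 : ℕ) : ℝ) with hLdef
  have hL : ∀ e, 0 ≤ L e := fun e => div_nonneg (Nat.cast_nonneg _) (Real.sqrt_nonneg _)
  have hsum : ∑ e, L e ^ 2 = (∑ e ∈ walkEdges w, (dartMult w e : ℝ) ^ 2) / 2 := by
    have h2 : Real.sqrt ((2 : ℕ) : ℝ) ^ 2 = 2 := by rw [Real.sq_sqrt (Nat.cast_nonneg _)]; norm_num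
    simp only [hLdef, div_pow, h2]
    rw [← Finset.sum_div, Finset.sum_coe_sort (walkEdges w) (fun e => (dartMult w e : ℝ) ^ 2)]
  have key := szzFunctionalInequalitiesWith_su2_sharp β hβ μ hμ (walkEdges w) f L hf hL hLip
  have hF : matrixCylinder (walkEdges w) f =
      wilsonLoopObs (fun g : Matrix.specialUnitaryGroup (Fin 2) ℂ => normalisedCharacter 2 (fundamentalRep (Fin 2) g)) w := funext hrep
  rw [hF, hsum] at key
  refine ⟨key.1.trans (le_of_eq ?_), key.2.trans (le_of_eq ?_)⟩
  · ring
  · rw [div_mul_eq_mul_div, one_mul, div_div]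

/-- ★★ **Variance of Wilson loops** under every infinite-volume limit point of `SU(2)` lattice Yang–Mills on `ℤ³` at 't Hooft coupling
`|β| < 1/24`: `Var_μ(W_C) ≤ Σ_{e ∈ links(C)} mult_C(e)² / (2(1 − 24|β|))` for every closed walk `C`.  The Yang–Mills mass gap is NOT
proved. [cite: ShenZhuZhu2022, Theorem 1.4, Corollary 1.5] -/
theorem szz_wilsonLoop_variance_su2 {β : ℝ} (hβ : |β| < 1 / 24)
    {μ : Measure (LGConfig 3 (Matrix.specialUnitaryGroup (Fin 2) ℂ))}
    (hμ : μ ∈ infiniteVolumeLimitPoints (d := 3) (fundamentalRep (Fin 2)) (((2 : ℕ) : ℝ) * β))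
    {x : Site 3} (w : (zdGraph 3).Walk x x) :
    Var[wilsonLoopObs (fun g : Matrix.specialUnitaryGroup (Fin 2) ℂ => normalisedCharacter 2 (fundamentalRep (Fin 2) g)) w; μ] ≤
      (∑ e ∈ walkEdges w, (dartMult w e : ℝ) ^ 2) / (2 * (1 - 24 * |β|)) :=
  (szz_wilsonLoop_entropy_variance_su2 hβ hμ w).2

/-- ★★ **Perimeter growth of Wilson-loop fluctuations, closed trails**: under every infinite-volume limit point of `SU(2)` lattice
Yang–Mills on `ℤ³` at 't Hooft coupling `|β| < 1/24`, `Var_μ(W_C) ≤ |C| / (2(1 − 24|β|))` for every closed trail `C` (no link used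
twice; e.g. every rectangle, `|C| = 2(R+T)`).  Shen–Zhu–Zhu Cor. 1.5 / Rem. 4.6 print `Var(W_C) ≲ |C|/(K_S N)` on `|β| < 1/32`.
The Yang–Mills mass gap is NOT proved. [cite: ShenZhuZhu2022, Corollary 1.5, Remark 4.6] -/
theorem szz_wilsonLoop_variance_su2_of_isTrail {β : ℝ} (hβ : |β| < 1 / 24)
    {μ : Measure (LGConfig 3 (Matrix.specialUnitaryGroup (Fin 2) ℂ))}
    (hμ : μ ∈ infiniteVolumeLimitPoints (d := 3) (fundamentalRep (Fin 2)) (((2 : ℕ) : ℝ) * β))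
    {x : Site 3} {w : (zdGraph 3).Walk x x} (htr : w.IsTrail) :
    Var[wilsonLoopObs (fun g : Matrix.specialUnitaryGroup (Fin 2) ℂ => normalisedCharacter 2 (fundamentalRep (Fin 2) g)) w; μ] ≤
      (w.length : ℝ) / (2 * (1 - 24 * |β|)) := by
  have h := szz_wilsonLoop_variance_su2 hβ hμ w
  rw [sum_dartMult_sq_eq_length_of_isTrail htr] at h
  exact h

/-- The defective log-Sobolev clause alone: `Ent_μ(W_C²) ≤ Σ_e mult_C(e)² / (1 − 24|β|)`; for a closed trail `≤ |C| / (1 − 24|β|)`.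
The Yang–Mills mass gap is NOT proved. [cite: ShenZhuZhu2022, Theorem 1.4] -/
theorem szz_wilsonLoop_entropy_su2_of_isTrail {β : ℝ} (hβ : |β| < 1 / 24)
    {μ : Measure (LGConfig 3 (Matrix.specialUnitaryGroup (Fin 2) ℂ))}
    (hμ : μ ∈ infiniteVolumeLimitPoints (d := 3) (fundamentalRep (Fin 2)) (((2 : ℕ) : ℝ) * β))
    {x : Site 3} {w : (zdGraph 3).Walk x x} (htr : w.IsTrail) :
    ∫ U, wilsonLoopObs (fun g : Matrix.specialUnitaryGroup (Fin 2) ℂ => normalisedCharacter 2 (fundamentalRep (Fin 2) g)) w U ^ 2 *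
          Real.log (wilsonLoopObs (fun g : Matrix.specialUnitaryGroup (Fin 2) ℂ => normalisedCharacter 2 (fundamentalRep (Fin 2) g)) w U ^ 2) ∂μ -
        (∫ U, wilsonLoopObs (fun g : Matrix.specialUnitaryGroup (Fin 2) ℂ => normalisedCharacter 2 (fundamentalRep (Fin 2) g)) w U ^ 2 ∂μ) *
          Real.log (∫ U, wilsonLoopObs (fun g : Matrix.specialUnitaryGroup (Fin 2) ℂ => normalisedCharacter 2 (fundamentalRep (Fin 2) g)) w U ^ 2 ∂μ)
      ≤ (w.length : ℝ) / (1 - 24 * |β|) := by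
  have h := (szz_wilsonLoop_entropy_variance_su2 hβ hμ w).1
  rw [sum_dartMult_sq_eq_length_of_isTrail htr] at h
  exact h

end Summit.QuantumFields.YangMills.Theorems.ColdStartUniversality

end
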